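import Literature.NumberTheory.DiophantineGeometry.GenEllDeFamilyBadPrimes
import Literature.NumberTheory.DiophantineGeometry.GenEllDeFamilyKappa
import HarnessLib

/-!
# [GenEll] Thm. 2.1 on the `D_e` route, FAMILY `t_c`: the conductor slope with the good places
# DISCHARGED off `S_bad(e, c, B)` (W5 kernel junction ∘ bad-prime plumbing; for W9)

S. Mochizuki, *Arithmetic elliptic curves in general position*, Math. J. Okayama Univ. **52** (2010),
Prop. 1.6 p. 10 / proof of Thm. 2.1 pp. 12–13 [cite: MochizukiGenEll2010, Prop 1.6 p.10]; support
file for the route item `GenEllTwo` (stmt-ABC-19679), abc-iut-S6's `GENELLTWO-P1ROUTE.md` v2 §4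
(OWNER RULING #6 + AMENDMENT: primary route = the one-parameter family `t_c := 1/r + c·r^{k+1}/s`,
«W5 must be stated for the family `t_c`»), W5 coordinator abc-iut-w5-d045.

The W5 package for the family is in the tree as: the good-place analysis `DeC.*`
(GenEllDeFamilyGoodPrimes / …Ord), its KERNEL JUNCTION with the summation over all places
`DeC.inv_finrank_mul_sum_logNorm_le_slope` (GenEllDeFamilyKappa, p416504 — hypotheses: a finite bad
set `Sbad` and, OFF `Sbad`, the five good-place facts `h2`/`hc`/`hBint`/`hBsep`/`hgap` + the converse
`hconv`), and the bad-prime plumbing `DeC.exists_badPrimes` (GenEllDeFamilyBadPrimes, p416861: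
a finite set `S_bad(e, c, B) ∋ 2` of rational primes off which the five facts hold in EVERY number
field `L ⊇ K`). This file performs the one remaining composition, so that the W9 assembly consumes a
single statement:

* `DeC.goodPlaceHyps_off_badPrimes_of_subset` — for any finite `T ⊇ S_bad(e, c, B)` and any `L ⊇ K`,
  the five facts re-packaged VERBATIM as the binders `h2`/`hc`/`hBint`/`hBsep`/`hgap` of the kernel
  junction (`Sbad := ⋃_{p∈T} placesOver L p`, `B ↦ B.map (K → L)`, every `g` in the family normal form);
* `DeC.inv_finrank_mul_sum_logNorm_le_slope_off_badPrimes` — **the conductor slope for the family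
  with the good places DISCHARGED**: `∃ S ∋ 2` (primes) such that for every finite `T ⊇ S`, every
  `L ⊇ K` and every point datum in the family normal forms with `N_c ≠ 0`, `t ∉ B`, the ONLY remaining
  inputs are `hconv` off `Sbad`, the meeting set `W`, the bad-place sums `hbad₁`/`hbad₂` over `Sbad`,
  the archimedean bound `harch` and the three height inputs — conclusion = the `hκ` shape
  `(1/[L:ℚ]) Σ_{w∈W} log N(w) ≤ ((|B|(2k+4) − (6k+6))/(2k+1))·(1/[L:ℚ])·h_L(x) + const` of
  `vojtaIneq_of_belyi_mechanism`.

Theorems only (0 defs); classical; nothing here bears on [IUTchIII] Cor. 3.12.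
-/

noncomputable section

namespace Literature.NumberTheory.DiophantineGeometry.GenEll

open _root_.Polynomial NumberField IsDedekindDomain Height
open Literature.IUT.LogVolume

universe u

section Slope

variable {K : Type u} [Field K] [NumberField K]

open scoped Classical in
/-- **The five good-place hypotheses of the family junctions, in CONSUMER form.** For `k`, `c ∈ K^×`,
`B ⊂ K` let `S = S_bad(e, c, B)` be as in `DeC.exists_badPrimes` (GenEllDeFamilyBadPrimes). Then for every finite `T ⊇ S` and
every number field `L ⊇ K`, with `Sbad := ⋃_{p∈T} placesOver L p`, `B′ := B.map (K → L)` and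
`c′ := algebraMap K L c`, the hypotheses `h2`, `hc`, `hBint`, `hBsep`, `hgap` of
`DeC.hmeet_hoff_of_gap` (GenEllDeFamilyGoodPrimesOrd) and of the W5 kernel junction
`DeC.inv_finrank_mul_sum_logNorm_le_slope` (GenEllDeFamilyKappa, abc-iut-w5-d045) hold VERBATIM in
their binder order (`∀ w, w ∉ Sbad → …`; the gap clause for every `g` in the family normal form at
`b ∈ B′`). [cite: MochizukiGenEll2010, Prop 1.6 p.10] -/
theorem DeC.goodPlaceHyps_off_badPrimes_of_subset (k : ℕ) {c : K} (hc : c ≠ 0) (B : Finset K) :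
    ∃ S : Finset ℕ, 2 ∈ S ∧ (∀ p ∈ S, p.Prime) ∧ ∀ T : Finset ℕ, S ⊆ T →
      ∀ (L : Type u) [Field L] [NumberField L] [Algebra K L],
        (∀ w : HeightOneSpectrum (𝓞 L), w ∉ T.attach.biUnion (fun p => placesOver L p.1) →
          w.valuation L (2 : L) = 1) ∧
        (∀ w : HeightOneSpectrum (𝓞 L), w ∉ T.attach.biUnion (fun p => placesOver L p.1) →
          w.valuation L (algebraMap K L c) = 1) ∧
        (∀ w : HeightOneSpectrum (𝓞 L), w ∉ T.attach.biUnion (fun p => placesOver L p.1) →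
          ∀ b ∈ B.map ⟨algebraMap K L, (algebraMap K L).injective⟩, w.valuation L b ≤ 1) ∧
        (∀ w : HeightOneSpectrum (𝓞 L), w ∉ T.attach.biUnion (fun p => placesOver L p.1) →
          ∀ b ∈ B.map ⟨algebraMap K L, (algebraMap K L).injective⟩,
          ∀ b' ∈ B.map ⟨algebraMap K L, (algebraMap K L).injective⟩, b ≠ b' →
            w.valuation L (b - b') = 1) ∧
        (∀ w : HeightOneSpectrum (𝓞 L), w ∉ T.attach.biUnion (fun p => placesOver L p.1) →
          ∀ b ∈ B.map ⟨algebraMap K L, (algebraMap K L).injective⟩, ∀ g : L[X],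
            g = C ((algebraMap K L c) ^ 2) * X ^ (2 * k + 4) + C (4 * b ^ 2) * X ^ (2 * k + 3)
              - C (8 * b) * X ^ (2 * k + 2) + C 4 * X ^ (2 * k + 1) - C (b ^ 2) * X ^ 2
              + C (2 * b) * X - 1 →
            ∀ ρ : L, w.valuation L ρ ≤ 1 → g.eval ρ ≠ 0 → w.valuation L (g.eval ρ) < 1 →
              w.valuation L (g.eval ρ) < w.valuation L ((derivative g).eval ρ)) := by
  classical
  obtain ⟨S, h2S, hSp, hS⟩ := DeC.exists_badPrimes (K := K) k hc B
  refine ⟨S, h2S, hSp, ?_⟩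
  intro T hST L _ _ _
  -- a place off `T` is off `S`
  have hoff : ∀ w : HeightOneSpectrum (𝓞 L), w ∉ T.attach.biUnion (fun p => placesOver L p.1) →
      w ∉ S.attach.biUnion (fun p => placesOver L p.1) := by
    intro w hw hwS
    obtain ⟨p, -, hp⟩ := Finset.mem_biUnion.mp hwS
    exact hw (Finset.mem_biUnion.mpr ⟨⟨p.1, hST p.2⟩, Finset.mem_attach _ _, hp⟩)
  refine ⟨fun w hw => (hS L w (hoff w hw)).1, fun w hw => (hS L w (hoff w hw)).2.1,
    fun w hw b hb => ?_, fun w hw b hb b' hb' hne => ?_, fun w hw b hb g hg ρ hρ hg0 hlt => ?_⟩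
  · obtain ⟨b₀, hb₀, rfl⟩ := Finset.mem_map.mp hb
    exact (hS L w (hoff w hw)).2.2.1 b₀ hb₀
  · obtain ⟨b₀, hb₀, rfl⟩ := Finset.mem_map.mp hb
    obtain ⟨b₀', hb₀', rfl⟩ := Finset.mem_map.mp hb'
    have hne₀ : b₀ ≠ b₀' := fun h => hne (by rw [h])
    exact (hS L w (hoff w hw)).2.2.2.1 b₀ hb₀ b₀' hb₀' hne₀
  · obtain ⟨b₀, hb₀, rfl⟩ := Finset.mem_map.mp hb
    exact (hS L w (hoff w hw)).2.2.2.2 b₀ hb₀ g hg ρ hρ hg0 hlt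

open scoped Classical in
/-- **The conductor slope for the family off `S_bad(e, c, B)` — W5 for `t_c` with the good places
DISCHARGED.** Composition of `DeC.goodPlaceHyps_off_badPrimes_of_subset` with abc-iut-w5-d045's kernel
junction `DeC.inv_finrank_mul_sum_logNorm_le_slope` (GenEllDeFamilyKappa): for `k`, `c ∈ K^×`, `B ⊂ K`
there is `S = S_bad(e, c, B) ∋ 2` such that for every finite `T ⊇ S`, every number field `L ⊇ K` and
every point datum in the family normal forms with `N_c ≠ 0`, `t ∉ B`, the ONLY remaining inputs are the
W5c converse `hconv` off `Sbad := ⋃_{p∈T} placesOver L p`, the meeting set `W`, the bad-place sums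
`hbad₁`/`hbad₂` over `Sbad`, the archimedean bound `harch` and the three height inputs; conclusion =
the `hκ` shape `(1/[L:ℚ]) Σ_{w∈W} log N(w) ≤ ((|B|(2k+4) − (6k+6))/(2k+1))·(1/[L:ℚ])·h_L(x) + const`.
[cite: MochizukiGenEll2010, Prop 1.6 p.10] -/
theorem DeC.inv_finrank_mul_sum_logNorm_le_slope_off_badPrimes (k : ℕ) {c : K} (hc : c ≠ 0)
    (B : Finset K) :
    ∃ S : Finset ℕ, 2 ∈ S ∧ (∀ p ∈ S, p.Prime) ∧ ∀ T : Finset ℕ, S ⊆ T →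
      ∀ (L : Type u) [Field L] [NumberField L] [Algebra K L] {r s t N x : L} {C₁ C₂ C₃ C₄ C₅ C₆ : ℝ},
        s ^ 2 = 1 - 4 * r ^ (2 * k + 1) → t * (r * s) = s + algebraMap K L c * r ^ (k + 2) →
        N = -s ^ 3 + algebraMap K L c * ((k + 1) * r ^ (k + 2) - 2 * r ^ (3 * k + 3)) → N ≠ 0 →
        (∀ b ∈ B, t ≠ algebraMap K L b) →
        ∀ W : Finset (HeightOneSpectrum (𝓞 L)),
        (∀ w : HeightOneSpectrum (𝓞 L), w ∉ T.attach.biUnion (fun p => placesOver L p.1) →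
          w.valuation L N < 1 →
            ∃ b ∈ B.map ⟨algebraMap K L, (algebraMap K L).injective⟩, w.valuation L (t - b) < 1) →
        (∀ w ∈ W, w ∉ T.attach.biUnion (fun p => placesOver L p.1) →
          ∃ b ∈ B.map ⟨algebraMap K L, (algebraMap K L).injective⟩, 0 < ord L w (t - b)) →
        (∑ w ∈ T.attach.biUnion (fun p => placesOver L p.1),
            ((ord L w N).toNat : ℝ) * logNorm L w ≤ Module.finrank ℚ L * C₁) →
        (∑ w ∈ T.attach.biUnion (fun p => placesOver L p.1), logNorm L w ≤ Module.finrank ℚ L * C₂) →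
        (∀ v : InfinitePlace L, Real.posLog (v N⁻¹) ≤ C₃) →
        ((2 * k + 1 : ℝ) * logHeight₁ t ≤ (2 * k + 4 : ℝ) * logHeight₁ x + Module.finrank ℚ L * C₄) →
        ((6 * k + 6 : ℝ) * logHeight₁ x ≤ (2 * k + 1 : ℝ) * logHeight₁ N + Module.finrank ℚ L * C₅) →
        (∀ b ∈ B.map ⟨algebraMap K L, (algebraMap K L).injective⟩,
          logHeight₁ b ≤ Module.finrank ℚ L * C₆) →
        (Module.finrank ℚ L : ℝ)⁻¹ * ∑ w ∈ W, logNorm L w ≤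
          ((B.card * (2 * k + 4 : ℝ) - (6 * k + 6)) / (2 * k + 1)) *
              ((Module.finrank ℚ L : ℝ)⁻¹ * logHeight₁ x) +
            ((B.card * C₄ + C₅) / (2 * k + 1) + B.card * (C₆ + Real.log 2) + C₁ + C₂ + C₃) := by
  classical
  obtain ⟨S, h2S, hSp, hS⟩ := DeC.goodPlaceHyps_off_badPrimes_of_subset (K := K) k hc B
  refine ⟨S, h2S, hSp, ?_⟩
  intro T hST L _ _ _ r s t N x C₁ C₂ C₃ C₄ C₅ C₆ hcurve ht hN hN0 htB W hconv hW hbad₁ hbad₂ harch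
    htH hNH hBH
  obtain ⟨h2, hcv, hBint, hBsep, hgap⟩ := hS T hST L
  have htB' : ∀ b ∈ B.map ⟨algebraMap K L, (algebraMap K L).injective⟩, t ≠ b := by
    intro b hb
    obtain ⟨b₀, hb₀, rfl⟩ := Finset.mem_map.mp hb
    exact htB b₀ hb₀
  have h := DeC.inv_finrank_mul_sum_logNorm_le_slope k hcurve ht hN hN0 _ htB'
    (fun d => C ((algebraMap K L c) ^ 2) * X ^ (2 * k + 4) + C (4 * d ^ 2) * X ^ (2 * k + 3)
      - C (8 * d) * X ^ (2 * k + 2) + C 4 * X ^ (2 * k + 1) - C (d ^ 2) * X ^ 2 + C (2 * d) * X - 1)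
    (fun _ _ => rfl) _ W h2 hcv hBint hBsep (fun w hw b hb => hgap w hw b hb _ rfl) hconv hW
    hbad₁ hbad₂ harch htH hNH hBH
  simpa only [Finset.card_map] using h

end Slope

end Literature.NumberTheory.DiophantineGeometry.GenEll
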